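import Summits.BirchSwinnertonDyer.BirchSwinnertonDyer.Theses.GenusKolyvaginAtTwo

/-!
# Route `GenusKolyvaginAtTwo`, LINE 13: the glue of the Q3R split holds (by name)

Item `EquivariantKolyvaginExactAtTwoROfHalves` (support/glue of the LINE-13 split of crux
`EquivariantKolyvaginExactAtTwoR` = Q3R, stmt-BirchSwinnertonDyer-27720, into its two divisibility halves
U `ShaCardDvdPowAtTwoR` (`#Ш(E/K)[2^∞] ∣ 2^(2M₀)`, annihilation) and L `PowDvdShaCardAtTwoR`
(`2^(2M₀) ∣ #Ш(E/K)[2^∞]`, structure ladder)). Pen seat `bsd-idea-1` g7. THEOREM-ONLY file (no definition,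
no named fact, no `sorry`): pure logic — introduce the common frame and apply `Nat.dvd_antisymm`.
BSD is not proved by this; Q3R is not proved by this (children ⟹ parent only); U and L stay open.
-/

set_option autoImplicit false
set_option linter.dupNamespace false
set_option linter.unusedVariables false

namespace Summit.BirchSwinnertonDyer.BirchSwinnertonDyer.Theorems.GenusExact

open Summit.BirchSwinnertonDyer.BirchSwinnertonDyer.Theses.GenusKolyvaginAtTwo

/-- **Glue of LINE 13** (by name): `ShaCardDvdPowAtTwoR → PowDvdShaCardAtTwoR → EquivariantKolyvaginExactAtTwoR`
— antisymmetry of `∣` on `ℕ` after introducing the common frame. [folklore] -/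
theorem equivariantKolyvaginExactAtTwoROfHalves_proof : EquivariantKolyvaginExactAtTwoROfHalves := by
  intro h₁ h₂ hQ2 hQ5R hQ1 W _ _ _ hcm hneg K _ _ hIQ hodd h3 hHe hsq1 hsq2 hρ Dt β ι d₁ hy M₀ hdiv hndiv n d hn hKoly hPn
  exact Nat.dvd_antisymm
    (h₁ hQ2 hQ5R hQ1 W hcm hneg K hIQ hodd h3 hHe hsq1 hsq2 hρ Dt β ι d₁ hy M₀ hdiv hndiv n d hn hKoly hPn)
    (h₂ hQ2 hQ5R hQ1 W hcm hneg K hIQ hodd h3 hHe hsq1 hsq2 hρ Dt β ι d₁ hy M₀ hdiv hndiv n d hn hKoly hPn)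

end Summit.BirchSwinnertonDyer.BirchSwinnertonDyer.Theorems.GenusExact
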